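import Summits.ResolutionOfSingularities.ResolutionOfSingularities.Theses.WeightedInvariant
import Summits.ResolutionOfSingularities.ResolutionOfSingularities.Theorems.WeightedInvariantTermination

/-!
# Disproof of `WeightedConstruction` (crux stmt-ResolutionOfSingularities-0571) — PART III

Standing-adversary work file, cdisprove **gen 3 / cycle 3** (2026-08-16,
refuter-cdisprove-stmt-ResolutionOfSingularities-0571-g3-0). `rc 0`, no `sorry`, prose only in
docstrings. This is the FIRST tree-resident part (`ledger crux write … Disproof.lean`); Parts I–II
live only as item evidence (`run/gate/evidence/stmt-…-0571/…-Disproof.lean`, not mounted in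
refuter seats) and are indexed below from their evidence notes. Part III does not restate their
lemmas; it adds the cycle-3 levers and cites theirs by name.

THE CRUX. `WeightedConstruction := ∀ p prime, Nonempty (WeightedResolutionDatum p)`
(`Literature.AlgebraicGeometry.Resolution.WeightedResolutionDatum`): one well-ordered `Γ`; for
every perfect `k` of char `p`, smooth separated quasi-compact `f : Y → Spec k` and ideal sheaf
`X` on `Y`, a usc invariant `inv f X : Y → Γ` and a Rees algebra `centre f X`, with `(i)`
functoriality (smooth `k`-morphisms / perfect ground-field extensions; centre: smooth SURJECTIVE),
`(ii)` `IsBot (inv y) ↔ X` regular-or-absent at `y`, and under the guard `∃ y, ¬ IsBot (inv y)`: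
`(iii)` regular weighted centre supported exactly on the maximum locus, `(iv)` strict drop of
`inv` at every point of every cobordant chart `B₊(U)` with the strict transform.

## Index of Parts I–II (evidence only; shas from the item's evidence list)

* PART I (g1, cycle 1, v3, sha dbbf554d, 2026-08-15T22:42Z): §1 zero-centre boundary
  (`centre_ne_zeroCentre`); §2 `not_wellFounded_atwLT` (ATW's order is not WF across dimensions:
  design flag S2 made precise); §3 `LaxDatum` = interface minus `(ii)` is inhabited by the
  constant model (`nonempty_laxDatum`): `(ii)` is the only axiom injecting `Sing X`; §4 Aut-forcing
  `inv_comp_iso` / `isMax_apply_of_aut` / `mem_support_centre_apply_of_aut`, §4.1b the CENTRE is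
  pinned only by GLOBAL automorphisms / surjective smooth covers, §4.2b Kollár Ex. 3.6.2
  (`x²+y²+z²t²`: weights (α,α,β,β) forced, α = 2β±1 reproduce ⇒ forbidden, α = 2β escapes); §5
  `aeval_scale_of_isWeightedHomogeneous` (q.h. germs die in one balanced move); §6 suspension
  class `V(xy+G²)`.
* PART II (g2, cycle 2, v2, sha 68e9218b, 2026-08-15T23:29Z): §2 `centre_ne_unit`; §3 kangaroo
  calibration (`x²+y⁷+yz⁴` is (7,2,3)-q.h., `y²f = (xy+y³z+z³)²+(y³+z²)³` in char 2 ⇒ dies in 2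
  canonical moves; Narasimhan (32,7,19,15)-q.h.); §4 symmetric forcing
  `X_mem_weightedMonomialIdeal_iff`, `weight_eq_of_map_rename_swap`; §5 weighted scaling; §6
  forcing evaporates E1–E4 (E3: conditional no-go, char-2 class 𝔅); §7 near-misses N1–N4.
  Verdict cycles 1–2: RESISTS.

## Findings of cycle 3 (this part)

* §C3.0 the crux by name; `IsEmpty (WeightedResolutionDatum p)` at one prime kills it
  (`not_crux_of_isEmpty`) — the target type of every kill criterion below.
* §C3.1 SYMMETRY LEVERS as theorems about an arbitrary datum `D` (generalising Part I §4 from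
  isomorphisms to smooth self-maps and correspondences): `inv_apply_eq_of_comap_eq` (any smooth
  self-map `σ` over `k` with `X.comap σ = X`), `inv_eq_of_comap_eq_comap` (two smooth legs
  `a, π : Z ⇉ Y` with equal pull-backs identify `inv` — the étale-correspondence form, which by
  Artin approximation covers every automorphism of the henselised germ), `mem_maxLocus_iff_of_comap_eq`,
  `centre_piece_eq_comap` (smooth surjective self-maps), `guard_of_smooth`; NEW CLASS
  `inv_comap_semilinear` / `centre_comap_semilinear`: an automorphism `α` of the SCHEME `Y` lying
  over a Frobenius power / field automorphism `φ` of `k` (`α ≫ f = f ≫ Spec φ`) is a cartesian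
  square, so `(i)` for ground-field extensions forces Frobenius-CONJUGATION invariance
  (`inv f (α⁻¹X) y = inv f X (α y)`): a datum built from non-`𝔽_p`-equivariant choices does not
  exist. (Consistent: every natural candidate is `𝔽_p`-definable.)
* §C3.2 KILL TEMPLATES, D-free. `false_of_smoothLocalEquivalence`: `(iv)+(i)` forbid any point of
  any `B₊(U)` to be smooth-locally equivalent over `k` to a maximum point ("reproduction ⇒
  contradiction", the only kill shape, Parts I §4 / II §6, now a theorem).
  `maxLocus_eq_of_isolated` / `centre_of_isolated`: at an isolated non-regular point the maximum
  locus is that point and the centre is a point-supported regular weighted centre FOR EVERY DATUM.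
  `not_nonempty_of_isolated_reproduction`: a D-FREE sufficient condition for
  `IsEmpty (WeightedResolutionDatum p)` — one pair `(Y, X)` with an isolated non-regular point
  `y₀` such that for EVERY regular weighted centre supported on `{y₀}` some point of some chart
  `B₊(U)` (strict transform) is smooth-locally equivalent to `(Y, X, y₀)`.
  `exists_isMax`, `maxLocus_eq_of_homogeneous`, `not_nonempty_of_homogeneous_reproduction`: the
  same with `{y₀}` replaced by a HOMOGENEOUS non-regular locus `Z` (the only nonempty closed
  subset of `Z` stable under a family of `X`-preserving smooth self-maps is `Z`; e.g. the axis of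
  the char-2 umbrella under the `p`-th-root translations `τ_c`) — then `Z` IS the maximum locus of
  every datum (so must be regular) and a kill needs reproduction for every centre supported on
  `Z`. These reduce a refutation of the crux to PURE LOCAL ALGEBRA about one germ; no datum needs
  to be handled.
* §C3.3 ENCODING AUDIT (junk inhabitant / cheap contradiction), cycle-3 pass: none — details and
  the five consistency checks (weight-1 divisorial centres are inert but unreachable; disjoint
  unions: values comparable across pairs, centre inside `Y ⊔ Z` NOT forced to be the standalone
  centre — design remark S3; Frobenius twists of the structure map; étale endomorphisms
  `id + gᵖ`; non-reduced / embedded `X`) in the §C3.3 docblock. The "complete-type" datum makes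
  `(iii)` FREE (homogeneity ⇒ the top stratum is regular; its weight-1 blow-up is canonical), so
  the crux is EXACTLY: a specialisation-monotone well-order on smooth-local types of pointed pairs
  with a positional drop on `B₊` — `LocalWeightedDrop` (stmt-8899) with globally consistent
  ratings. No slack in the interface either way.
* §C3.4 FAMILIES run this cycle (all die; computations in the docblock): binomial / toric
  hypersurfaces `xᵖ + yᵃzᵇ` (torus + swap pin the centre to coordinate weights; 2 moves);
  `xᵖ + yᵖz`, `xᵖ + z·y^{pa'}` (`τ_c : (x,y,z) ↦ (x + c^{1/p}y, y, z − c)` forces `α ≤ β`;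
  `α = β` is q.h. in `(x,y)` with `Sing ⊆ V(x,y)` ⇒ one move); the `𝔾_a`-class
  `f = F(y, xᵖ + yᵖz)` (e.g. `(x²+y²z+y³)² + y⁷`, char 2, not q.h.: max locus = `z`-axis
  forced by `maxLocus_eq_of_homogeneous`, the (1,1) axis blow-up leaves `z₂² + u s³ ≅` cusp `× 𝔸²`
  or the binomial `z² + y sᵐ` ⇒ dies in ≤ 3); char-2 umbrella; non-reduced `V(x²)`, `(x²,xy)`,
  `x·(x,y)ᴺ`, `V(f²)`. ONE-STEP PRINCIPLE (Parts I–II §5, restated): `f` q.h. for weights on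
  variables `u` with `Sing V(f) ⊆ V(u)` ⇒ the `u`-weighted cobordant blow-up resolves in one
  move (`X' ∩ B₊ =` types of `V(f) ∖ V(u)` `× 𝔸¹_s`). Every family symmetric enough to PIN the
  centre that we know is q.h./toric and dies by it; asymmetric families leave the designer free.
* Targets: none (payload `stuck_stubs = []`, no line picked yet for this crux).

## WHY IT RESISTS (cycle 3)

The interface has no slack: `(ii)` is the only axiom that sees `X` (Part I §3) and it, `(usc)`,
`(i)` are met by the indicator of the singular locus; `(iii)` is met for free by any complete
smooth-local invariant; everything is in `(iv)`. By §C3.2 a refutation is equivalent to exhibiting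
ONE germ (isolated or homogeneous non-regular locus) that reproduces itself smooth-locally on `B₊`
of EVERY admissible (by §C3.1: `Aut`-, correspondence- and Frobenius-conjugation-invariant)
regular weighted centre. Germs with enough symmetry to make "every admissible centre" a small set
are quasi-homogeneous or toric and never reproduce (one-step principle); germs without symmetry
leave infinitely many centres to defeat and no invariant of the germ is known that survives all of
them (the census specimen `z⁸ + x²y⁸(1+y)` over `𝔽₂` defeats point centres for the numerical pair
`(ν, ν₁)` only, and its axis centre wins — ideator r1-k1 / triage r1-1). A kill therefore needs
new mathematics (a char-`p` germ whose local symmetry fixes no droppable centre), exactly the open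
core that AbramovichTemkinWlodarczyk2024 §1.9 and AQS arXiv:2412.16426 name. Literature sweep
2026-08-16 (degraded: local FTS down, OpenAlex/S2 429; arXiv/zbMATH/Crossref up): no printed
no-go; arXiv:2602.06553 (AlphaEvolve ranking functions, char 3) is experimental/conjectural.

## HANDOFF (for cycle 4 / re-arm)

* Landed under `Theorems/…/Negative/`: nothing (all cycle-3 lemmas are ABOUT an arbitrary datum or
  D-free criteria; none is a `¬`-statement of a Theses decl). Nothing sorried.
* On re-arm with `targets`: instantiate `false_of_smoothLocalEquivalence` /
  `not_nonempty_of_*_reproduction` against the lead's stubs; a stub asserting a drop for a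
  SPECIFIC centre family is attackable by exhibiting a reproducing germ for that family only.
* Next regimes: (1) germs with positive-dimensional NON-reductive local symmetry not preserving
  any flag (would make §C3.2's "every centre" empty ⇒ instant kill; none found: `τ_c`-type
  symmetries only bound weights, `α ≤ jβ`); (2) the calibration `Nonempty (WeightedResolutionDatum 0)`
  (route-review S2) — if planners file it, its failure mode (re-ranking across dimensions) is the
  same as here; (3) multi-germ forcing via `maxLocus_eq_of_homogeneous` on products `X × X'`.
-/

noncomputable section

open CategoryTheory AlgebraicGeometry TopologicalSpace
open Literature.AlgebraicGeometry.Resolution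
open Summit.ResolutionOfSingularities.ResolutionOfSingularities.Theses.WeightedInvariant

set_option linter.dupNamespace false

namespace Summit.ResolutionOfSingularities.ResolutionOfSingularities.Cruxes.WeightedConstruction.Disproof

/-! ## §C3.0 The crux by name -/

/-- Unfolding: the crux is `∀ p prime, Nonempty (WeightedResolutionDatum p)`. [folklore] -/
theorem crux_iff :
    WeightedConstruction ↔ ∀ p : ℕ, p.Prime → Nonempty (WeightedResolutionDatum p) := Iff.rfl

/-- **Target type of every kill.** Emptiness of the datum type at ONE prime refutes the crux.
[folklore] -/
theorem not_crux_of_isEmpty {p : ℕ} (hp : p.Prime) (h : IsEmpty (WeightedResolutionDatum p)) :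
    ¬ WeightedConstruction :=
  fun hC => (hC p hp).elim fun D => h.false D

variable {p : ℕ} (D : WeightedResolutionDatum p)

/-! ## §C3.1 Symmetry levers (what every datum must respect) -/

section Symmetry

variable {k : Type} [Field k] [CharP k p] [PerfectField k]
  {Y : Scheme.{0}} (f : Y ⟶ Spec (.of k)) [Smooth f] [IsSeparated f] [QuasiCompact f]

/-- **Symmetry lever (inv).** `inv` is invariant under every SMOOTH self-map `σ` of `Y` over `k`
that pulls `X` back to itself (automorphisms, translations, torus actions, étale
self-correspondences): a specialisation of axiom `(i)` with `Y₁ = Y`, `g = σ`. [folklore] -/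
theorem inv_apply_eq_of_comap_eq (σ : Y ⟶ Y) [Smooth σ] (hσ : σ ≫ f = f)
    (X : Y.IdealSheafData) (hX : X.comap σ = X) (y : Y) :
    D.inv f X (σ y) = D.inv f X y := by
  have h := D.inv_comap f f σ hσ X y
  rw [hX] at h
  exact h.symm

/-- **Two smooth maps with the same pull-back identify `inv`.** If `a, π : Z → Y` are smooth
`k`-morphisms from one smooth separated quasi-compact `k`-scheme with `X.comap a = X.comap π`
(e.g. the action and the projection of a group scheme acting on `(Y, X)`, or the two legs of an
étale correspondence realising a formal automorphism of a germ), then `inv (a z) = inv (π z)`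
for every `z`. [folklore] -/
theorem inv_eq_of_comap_eq_comap {Z : Scheme.{0}} (h : Z ⟶ Spec (.of k)) [Smooth h]
    [IsSeparated h] [QuasiCompact h] (a π : Z ⟶ Y) [Smooth a] [Smooth π]
    (ha : a ≫ f = h) (hπ : π ≫ f = h) (X : Y.IdealSheafData) (hX : X.comap a = X.comap π)
    (z : Z) : D.inv f X (a z) = D.inv f X (π z) := by
  rw [← D.inv_comap f h a ha X z, ← D.inv_comap f h π hπ X z, hX]

/-- The maximum locus of `inv` is stable under every smooth self-map preserving `X` (both
directions, since membership depends on the value only). [folklore] -/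
theorem mem_maxLocus_iff_of_comap_eq (σ : Y ⟶ Y) [Smooth σ] (hσ : σ ≫ f = f)
    (X : Y.IdealSheafData) (hX : X.comap σ = X) (y : Y) :
    (∀ y' : Y, D.inv f X y' ≤ D.inv f X (σ y)) ↔ ∀ y' : Y, D.inv f X y' ≤ D.inv f X y := by
  rw [inv_apply_eq_of_comap_eq D f σ hσ X hX y]

/-- **Symmetry lever (centre).** Under the guard, the centre is invariant under every smooth
SURJECTIVE self-map of `Y` over `k` preserving `X`: all its graded pieces are `σ`-stable ideal
sheaves. For a torus acting on `(𝔸ⁿ, X)` this makes every piece a monomial ideal; for the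
`p`-th-root translations `τ_c` of §C3-A it bounds the weights. [folklore] -/
theorem centre_piece_eq_comap (σ : Y ⟶ Y) [Smooth σ] [Surjective σ] (hσ : σ ≫ f = f)
    (X : Y.IdealSheafData) (hX : X.comap σ = X) (hguard : ∃ y : Y, ¬ IsBot (D.inv f X y))
    (n : ℕ) : (D.centre f X).piece n = ((D.centre f X).piece n).comap σ := by
  have h := D.centre_comap f f σ hσ X hguard n
  rw [hX] at h
  exact h

/-- The guard propagates along smooth maps whose image meets a non-minimal point. [folklore] -/
theorem guard_of_smooth {Y₁ : Scheme.{0}} (f₁ : Y₁ ⟶ Spec (.of k)) [Smooth f₁] [IsSeparated f₁]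
    [QuasiCompact f₁] (g : Y₁ ⟶ Y) [Smooth g] (hg : g ≫ f = f₁) (X : Y.IdealSheafData)
    (y₁ : Y₁) (hy : ¬ IsBot (D.inv f X (g y₁))) :
    ∃ y : Y₁, ¬ IsBot (D.inv f₁ (X.comap g) y) :=
  ⟨y₁, by rwa [D.inv_comap f f₁ g hg X y₁]⟩

end Symmetry

section Semilinear

variable {k : Type} [Field k] [CharP k p] [PerfectField k]
  {Y : Scheme.{0}} (f : Y ⟶ Spec (.of k)) [Smooth f] [IsSeparated f] [QuasiCompact f]

/-- **Semilinear (Frobenius-twisted) conjugation invariance.** For a ring endomorphism `φ` of the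
perfect ground field inducing an isomorphism of `Spec k` (e.g. the Frobenius `c ↦ c ^ p` or any
field automorphism) and an automorphism `α` of the SCHEME `Y` lying over it
(`α ≫ f = f ≫ Spec φ`; `α` is NOT a `k`-morphism), the square is cartesian, so axiom `(i)` for
ground-field extensions applies with `K = k`: `inv` of the conjugate pair `(Y, α⁻¹X)` at `y` is
`inv` of `(Y, X)` at `α y`. Any `𝔽_p`-definable construction has this symmetry; a datum built
from choices that are not Frobenius-equivariant does not exist. [folklore] -/
theorem inv_comap_semilinear (φ : k →+* k) [IsIso (Spec.map (CommRingCat.ofHom φ))]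
    (α : Y ⟶ Y) [IsIso α] (hsq : α ≫ f = f ≫ Spec.map (CommRingCat.ofHom φ))
    (X : Y.IdealSheafData) (y : Y) : D.inv f (X.comap α) y = D.inv f X (α y) :=
  D.inv_baseChange φ f f α (IsPullback.of_horiz_isIso ⟨hsq⟩) X y

/-- Same for the centre, under the guard. [folklore] -/
theorem centre_comap_semilinear (φ : k →+* k) [IsIso (Spec.map (CommRingCat.ofHom φ))]
    (α : Y ⟶ Y) [IsIso α] (hsq : α ≫ f = f ≫ Spec.map (CommRingCat.ofHom φ))
    (X : Y.IdealSheafData) (hguard : ∃ y : Y, ¬ IsBot (D.inv f X y)) (n : ℕ) :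
    (D.centre f (X.comap α)).piece n = ((D.centre f X).piece n).comap α :=
  D.centre_baseChange φ f f α (IsPullback.of_horiz_isIso ⟨hsq⟩) X hguard n

end Semilinear

/-! ## §C3.2 Kill templates and D-free kill criteria -/

section KillTemplate

variable {k : Type} [Field k] [CharP k p] [PerfectField k]
  {Y : Scheme.{0}} (f : Y ⟶ Spec (.of k)) [Smooth f] [IsSeparated f] [QuasiCompact f]

/-- **Kill template (reproduction ⇒ contradiction).** No point `b` of a cobordant blow-up chart
`B₊(U)` (with the strict transform `X'`) is smooth-locally equivalent over `k` to a maximum point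
`y` of `(Y, X)`: if a smooth separated quasi-compact `k`-scheme `W` carries smooth `k`-maps
`g₁ : W → B₊(U)`, `g₂ : W → Y` with `X'.comap g₁ = X.comap g₂` and a point `w` over both `b` and
`y`, then axiom `(i)` gives `inv b = inv_W w = inv y`, against the strict drop `(iv)`. This is the
exact shape a counterexample to `WeightedConstruction` must take ("the singularity reproduces
itself, up to smooth-local equivalence, on B₊ of every admissible centre"). [folklore] -/
theorem false_of_smoothLocalEquivalence (X : Y.IdealSheafData)
    (hguard : ∃ y : Y, ¬ IsBot (D.inv f X y)) (U : Y.affineOpens)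
    (b : ↥((D.centre f X).cobordantPlus U)) (y : Y) (hy : ∀ y' : Y, D.inv f X y' ≤ D.inv f X y)
    [Smooth ((D.centre f X).cobordantPlusι U ≫ f)] [IsSeparated ((D.centre f X).cobordantPlusι U ≫ f)]
    [QuasiCompact ((D.centre f X).cobordantPlusι U ≫ f)]
    {W : Scheme.{0}} (h : W ⟶ Spec (.of k)) [Smooth h] [IsSeparated h] [QuasiCompact h]
    (g₁ : W ⟶ (D.centre f X).cobordantPlus U) [Smooth g₁]
    (hg₁ : g₁ ≫ ((D.centre f X).cobordantPlusι U ≫ f) = h)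
    (g₂ : W ⟶ Y) [Smooth g₂] (hg₂ : g₂ ≫ f = h) (w : W) (hw₁ : g₁ w = b) (hw₂ : g₂ w = y)
    (hX : ((D.centre f X).cobordantStrictTransform U X).comap g₁ = X.comap g₂) : False := by
  have hlt := D.inv_cobordantPlus_lt f X hguard U b y hy
  have h₁ := D.inv_comap ((D.centre f X).cobordantPlusι U ≫ f) h g₁ hg₁
    ((D.centre f X).cobordantStrictTransform U X) w
  have h₂ := D.inv_comap f h g₂ hg₂ X w
  rw [hX, hw₁] at h₁
  rw [hw₂] at h₂
  rw [← h₁, h₂] at hlt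
  exact lt_irrefl _ hlt

omit [CharP k p] [PerfectField k] [Smooth f] [IsSeparated f] [QuasiCompact f] in
/-- **Isolated non-regular point ⇒ the maximum locus is that point, for EVERY datum.** If `inv` is
minimal at every point other than `y₀` (e.g. `X` is regular or absent away from `y₀`) and not
minimal at `y₀`, then `y₀` is a maximum point and every maximum point equals `y₀`; hence (under
`(iii)`) the centre of ANY datum is a regular weighted centre supported exactly on `{y₀}` — the
designer's only freedom at an isolated singularity is the choice of the weighted centre germ.
[folklore] -/
theorem maxLocus_eq_of_isolated (X : Y.IdealSheafData) (y₀ : Y)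
    (hiso : ∀ y : Y, y ≠ y₀ → IsBot (D.inv f X y)) (hy₀ : ¬ IsBot (D.inv f X y₀)) :
    {y : Y | ∀ y' : Y, D.inv f X y' ≤ D.inv f X y} = {y₀} := by
  ext y
  simp only [Set.mem_setOf_eq, Set.mem_singleton_iff]
  constructor
  · intro hmax
    by_contra hne
    exact hy₀ (fun γ => (hmax y₀).trans (hiso y hne γ))
  · intro hy y'
    rw [hy]
    by_cases hy' : y' = y₀
    · rw [hy']
    · exact hiso y' hy' _

/-- Under the hypotheses of `maxLocus_eq_of_isolated`, the centre of every datum is supported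
exactly on `{y₀}` and is a regular weighted centre. [folklore] -/
theorem centre_of_isolated (X : Y.IdealSheafData) (y₀ : Y)
    (hiso : ∀ y : Y, y ≠ y₀ → IsBot (D.inv f X y)) (hy₀ : ¬ IsBot (D.inv f X y₀)) :
    (D.centre f X).IsRegularWeightedCentre ∧ (D.centre f X).support = {y₀} := by
  refine ⟨D.isRegularWeightedCentre_centre f X ⟨y₀, hy₀⟩, ?_⟩
  rw [D.support_centre f X ⟨y₀, hy₀⟩]
  exact maxLocus_eq_of_isolated D f X y₀ hiso hy₀

/-- **D-free kill criterion at an isolated singularity.** Suppose `(Y, X)` has a point `y₀` such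
that `X` is regular-or-absent at every other point and non-regular at `y₀` (an isolated
non-regular point, read through axiom `(ii)`), and suppose that for EVERY regular weighted centre
`R` on `Y` supported exactly on `{y₀}` some point of some chart `B₊^R(U)` with the strict
transform of `X` is smooth-locally equivalent over `k` to `(Y, X, y₀)` (hypothesis `hkill`, with
the smoothness instances of the chart supplied). Then no weighted resolution datum exists in
characteristic `p`. This isolates exactly what a counterexample germ must do: defeat ALL
admissible centres at once (by §C3-A only the `Aut`-invariant ones can occur, which is what makes
symmetric germs the natural candidates — and §C3-B is why they nevertheless all die).
[folklore] -/
theorem not_nonempty_of_isolated_reproduction (y₀ : Y) (X : Y.IdealSheafData)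
    (hreg : ∀ y : Y, y ≠ y₀ → ∀ x : X.subscheme, X.subschemeι x = y →
      IsRegularLocalRing (X.subscheme.presheaf.stalk x))
    (hsing : ∃ x : X.subscheme, X.subschemeι x = y₀ ∧
      ¬ IsRegularLocalRing (X.subscheme.presheaf.stalk x))
    (hkill : ∀ R : ReesAlgebraData Y, R.IsRegularWeightedCentre → R.support = {y₀} →
      ∃ (U : Y.affineOpens) (b : ↥(R.cobordantPlus U))
        (_ : Smooth (R.cobordantPlusι U ≫ f)) (_ : IsSeparated (R.cobordantPlusι U ≫ f))
        (_ : QuasiCompact (R.cobordantPlusι U ≫ f))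
        (W : Scheme.{0}) (h : W ⟶ Spec (.of k)) (_ : Smooth h) (_ : IsSeparated h)
        (_ : QuasiCompact h) (g₁ : W ⟶ R.cobordantPlus U) (_ : Smooth g₁)
        (_ : g₁ ≫ (R.cobordantPlusι U ≫ f) = h) (g₂ : W ⟶ Y) (_ : Smooth g₂) (_ : g₂ ≫ f = h)
        (w : W), g₁ w = b ∧ g₂ w = y₀ ∧
          (R.cobordantStrictTransform U X).comap g₁ = X.comap g₂) :
    IsEmpty (WeightedResolutionDatum p) := by
  refine ⟨fun D => ?_⟩
  have hy₀ : ¬ IsBot (D.inv f X y₀) := by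
    rw [D.isBot_inv_iff f X y₀]
    intro H
    obtain ⟨x, hx, hnreg⟩ := hsing
    exact hnreg (H x hx)
  have hiso : ∀ y : Y, y ≠ y₀ → IsBot (D.inv f X y) := fun y hy =>
    (D.isBot_inv_iff f X y).mpr (hreg y hy)
  obtain ⟨hcentre, hsupp⟩ := centre_of_isolated D f X y₀ hiso hy₀
  obtain ⟨U, b, i₁, i₂, i₃, W, h, j₁, j₂, j₃, g₁, l₁, hg₁, g₂, l₂, hg₂, w, hw₁, hw₂, hX⟩ :=
    hkill (D.centre f X) hcentre hsupp
  have hmax : ∀ y' : Y, D.inv f X y' ≤ D.inv f X y₀ := by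
    have := maxLocus_eq_of_isolated D f X y₀ hiso hy₀
    have hmem : y₀ ∈ {y : Y | ∀ y' : Y, D.inv f X y' ≤ D.inv f X y} := by
      rw [this]; exact Set.mem_singleton y₀
    exact hmem
  exact false_of_smoothLocalEquivalence D f X ⟨y₀, hy₀⟩ U b y₀ hmax h g₁ hg₁ g₂ hg₂ w hw₁ hw₂ hX

end KillTemplate

section Homogeneous

variable {k : Type} [Field k] [CharP k p] [PerfectField k]
  {Y : Scheme.{0}} (f : Y ⟶ Spec (.of k)) [Smooth f] [IsSeparated f] [QuasiCompact f]

/-- **A maximum point exists** (on a nonempty Noetherian `Y`): the order-theoretic core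
`exists_max_of_isClosed_superlevel` of Theorems/WeightedInvariantTermination applied to `(usc)`.
[folklore] -/
theorem exists_isMax [NoetherianSpace Y] [Nonempty Y] (X : Y.IdealSheafData) :
    ∃ y : Y, ∀ y' : Y, D.inv f X y' ≤ D.inv f X y :=
  Literature.AlgGeom.exists_max_of_isClosed_superlevel (D.inv f X) (D.isClosed_superlevel f X)

/-- **Homogeneous non-regular locus ⇒ it IS the maximum locus, for EVERY datum.** Let `Z ⊆ Y` be
the set of points where `inv` is not minimal (by `(ii)`: the points of `X` where `X` is not
regular) and suppose a family of smooth self-maps `σ i` of `Y` over `k` preserving `X` acts on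
`Z` "minimally": the only nonempty closed `σ`-stable subset of `Z` is `Z` itself (e.g. `Z` an
orbit closure of a group of automorphisms acting transitively on the closed points of an
irreducible `Z` — the `z`-axis of the characteristic-2 Whitney umbrella under the `p`-th-root
translations `τ_c`, the singular line of `xᵖ + yᵖz`, …). Then the maximum locus of `inv` is
exactly `Z`, whatever the datum: so `Z` must be regular (axiom `(iii)`), and the centre of every
datum is a regular weighted centre supported exactly on `Z`. [folklore] -/
theorem maxLocus_eq_of_homogeneous [NoetherianSpace Y] (X : Y.IdealSheafData) (Z : Set Y)
    (hbot : ∀ y : Y, y ∉ Z → IsBot (D.inv f X y)) (hnb : ∀ y ∈ Z, ¬ IsBot (D.inv f X y))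
    (hne : Z.Nonempty) {ι : Type*} (σ : ι → (Y ⟶ Y)) [∀ i, Smooth (σ i)]
    (hσf : ∀ i, σ i ≫ f = f) (hσX : ∀ i, X.comap (σ i) = X)
    (hZ : ∀ C : Set Y, C ⊆ Z → IsClosed C → C.Nonempty → (∀ i y, σ i y ∈ C ↔ y ∈ C) → C = Z) :
    {y : Y | ∀ y' : Y, D.inv f X y' ≤ D.inv f X y} = Z := by
  obtain ⟨z₀, hz₀⟩ := hne
  haveI : Nonempty Y := ⟨z₀⟩
  obtain ⟨y₀, hy₀⟩ := exists_isMax D f X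
  apply hZ
  · intro y hy
    by_contra hyZ
    exact hnb z₀ hz₀ (fun γ => (hy z₀).trans (hbot y hyZ γ))
  · have : {y : Y | ∀ y' : Y, D.inv f X y' ≤ D.inv f X y} = {y : Y | D.inv f X y₀ ≤ D.inv f X y} := by
      ext y
      exact ⟨fun h => h y₀, fun h y' => (hy₀ y').trans h⟩
    rw [this]
    exact D.isClosed_superlevel f X _
  · exact ⟨y₀, hy₀⟩
  · intro i y
    have h := D.inv_comap f f (σ i) (hσf i) X y
    rw [hσX i] at h
    simp only [Set.mem_setOf_eq]
    rw [← h]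

/-- **D-free kill criterion, homogeneous form.** With `Z`, `σ` as in `maxLocus_eq_of_homogeneous`
(read through `(ii)`: `X` regular-or-absent off `Z`, non-regular on `Z`), if for EVERY regular
weighted centre `R` supported exactly on `Z` some point of some cobordant chart `B₊^R(U)` with the
strict transform of `X` is smooth-locally equivalent over `k` to `(Y, X, z)` for some `z ∈ Z`,
then there is no weighted resolution datum in characteristic `p`. (The isolated-point criterion
is the case `Z = {y₀}`, `ι = ∅`, where Noetherianity is not needed.) [folklore] -/
theorem not_nonempty_of_homogeneous_reproduction [NoetherianSpace Y] (X : Y.IdealSheafData)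
    (Z : Set Y)
    (hreg : ∀ y : Y, y ∉ Z → ∀ x : X.subscheme, X.subschemeι x = y →
      IsRegularLocalRing (X.subscheme.presheaf.stalk x))
    (hsing : ∀ y ∈ Z, ∃ x : X.subscheme, X.subschemeι x = y ∧
      ¬ IsRegularLocalRing (X.subscheme.presheaf.stalk x))
    (hne : Z.Nonempty) {ι : Type*} (σ : ι → (Y ⟶ Y)) [∀ i, Smooth (σ i)]
    (hσf : ∀ i, σ i ≫ f = f) (hσX : ∀ i, X.comap (σ i) = X)
    (hZ : ∀ C : Set Y, C ⊆ Z → IsClosed C → C.Nonempty → (∀ i y, σ i y ∈ C ↔ y ∈ C) → C = Z)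
    (hkill : ∀ R : ReesAlgebraData Y, R.IsRegularWeightedCentre → R.support = Z →
      ∃ (U : Y.affineOpens) (b : ↥(R.cobordantPlus U))
        (_ : Smooth (R.cobordantPlusι U ≫ f)) (_ : IsSeparated (R.cobordantPlusι U ≫ f))
        (_ : QuasiCompact (R.cobordantPlusι U ≫ f))
        (W : Scheme.{0}) (h : W ⟶ Spec (.of k)) (_ : Smooth h) (_ : IsSeparated h)
        (_ : QuasiCompact h) (g₁ : W ⟶ R.cobordantPlus U) (_ : Smooth g₁)
        (_ : g₁ ≫ (R.cobordantPlusι U ≫ f) = h) (g₂ : W ⟶ Y) (_ : Smooth g₂) (_ : g₂ ≫ f = h)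
        (w : W), g₂ w ∈ Z ∧ g₁ w = b ∧
          (R.cobordantStrictTransform U X).comap g₁ = X.comap g₂) :
    IsEmpty (WeightedResolutionDatum p) := by
  refine ⟨fun D => ?_⟩
  have hnb : ∀ y ∈ Z, ¬ IsBot (D.inv f X y) := by
    intro y hy H
    rw [D.isBot_inv_iff f X y] at H
    obtain ⟨x, hx, hnreg⟩ := hsing y hy
    exact hnreg (H x hx)
  have hbot : ∀ y : Y, y ∉ Z → IsBot (D.inv f X y) := fun y hy =>
    (D.isBot_inv_iff f X y).mpr (hreg y hy)
  have hmax := maxLocus_eq_of_homogeneous D f X Z hbot hnb hne σ hσf hσX hZ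
  obtain ⟨z₀, hz₀⟩ := hne
  have hguard : ∃ y : Y, ¬ IsBot (D.inv f X y) := ⟨z₀, hnb z₀ hz₀⟩
  have hcentre := D.isRegularWeightedCentre_centre f X hguard
  have hsupp : (D.centre f X).support = Z := by rw [D.support_centre f X hguard, hmax]
  obtain ⟨U, b, i₁, i₂, i₃, W, h, j₁, j₂, j₃, g₁, l₁, hg₁, g₂, l₂, hg₂, w, hwZ, hw₁, hX⟩ :=
    hkill (D.centre f X) hcentre hsupp
  have hy : ∀ y' : Y, D.inv f X y' ≤ D.inv f X (g₂ w) := by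
    have hmem : g₂ w ∈ {y : Y | ∀ y' : Y, D.inv f X y' ≤ D.inv f X y} := by rw [hmax]; exact hwZ
    exact hmem
  have hlt := D.inv_cobordantPlus_lt f X hguard U b (g₂ w) hy
  have h₁ := D.inv_comap ((D.centre f X).cobordantPlusι U ≫ f) h g₁ hg₁
    ((D.centre f X).cobordantStrictTransform U X) w
  have h₂ := D.inv_comap f h g₂ hg₂ X w
  rw [hX, hw₁] at h₁
  rw [← h₁, h₂] at hlt
  exact lt_irrefl _ hlt

end Homogeneous

/-! ## §C3.3 Encoding audit, cycle 3 (junk inhabitant / cheap contradiction): NONE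

(A) JUNK INHABITANT. `(ii)` forces `inv` to detect regularity of `X.subscheme` stalks; the
two-valued indicator `inv = [X non-regular at y]` satisfies `(usc)` (singular locus closed on an
excellent scheme), `(i)` (regularity ascends/descends along smooth maps; is insensitive to
extensions of a PERFECT ground field) and `(ii)`, but fails `(iii)` on `X = V(xyz) ⊂ 𝔸³` (max
locus = three axes, not regular at `0`). Refining to the COMPLETE smooth-local type makes `(iii)`
free: the top stratum `S` of a single type is closed by `(usc)` (Jacobson: the generic points of
`S` carry the same value, cf. the `z`-axis computation in §C3.4) and regular (étale-homogeneous
reduced scheme of finite type over a perfect field), and its weight-1 cobordant blow-up is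
canonical, hence `Aut`-invariant. So NO axiom but `(iv)` has content beyond bookkeeping, and
`(iv)` for the complete-type datum is a WELL-ORDER on types, monotone under specialisation,
dropping positionally on `B₊`: the crux carries exactly the difficulty of `LocalWeightedDrop`
(stmt-8899) plus global consistency of ratings. No junk.

(B) CHEAP CONTRADICTION — five consistency checks, all pass:
1. Weight-1 divisorial centre `(u¹)`, `m = 1`: `A[t⁻¹, ut] → A[(ut)^{±1}]` inverts `ut` on `B₊`,
   and `t⁻¹ = u·(ut)⁻¹`, so `B₊ = Spec A[(ut)^{±1}] = U × 𝔾ₘ` with SMOOTH SURJECTIVE projection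
   and strict transform `(I_X : u^∞)`; for `X` without `u`-torsion this is `X × 𝔾ₘ = X.comap pr`,
   and `(i)` would give `inv b = max` over the centre, contradicting `(iv)`. Harmless: the max
   locus lies in the non-regular locus of `X`, which is a divisor of `Y` only along a non-reduced
   divisorial component of `X`, and there `(I_X : u^∞)` DROPS that component (e.g. `V(x²) ⊂ 𝔸²`:
   strict transform `= (1)`; `V(x²y)`: `= (y)`), so no reproduction. Lesson for constructions:
   a datum may use weight 1 on a divisor only to discard multiplicity.
2. Disjoint unions `(Y ⊔ Z, X ⊔ W)`: by `(i)` for the two open immersions the VALUES of `inv` are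
   globally comparable across pairs (one `Γ`); the centre on the `Z`-summand is pinned by `(iii)`
   (support = max locus ∩ Z, forced unit on the summand of smaller maximum) but NOT forced to equal
   `centre (Z, W)` — `centre_comap` asks `Surjective g` and `Z ↪ Y ⊔ Z` is not. DESIGN REMARK S3
   (not a refutation, mild): the interface lets a datum choose different centres for `(Z, W)`
   alone and for `Z` inside a disjoint union with an equally bad `Y`; ATW's centre is local, so a
   construction will not use the freedom, and an assembly proof must not assume locality of
   `centre` beyond `centre_comap`.
3. Frobenius twists of the structure map (`f ↦ f ≫ Spec Frob`): `inv_baseChange` with `pr = 𝟙`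
   shows `inv` is unchanged — consistent, and the source of `inv_comap_semilinear` (§C3.1).
4. Étale endomorphisms of `𝔸ⁿ` in char `p`, `σ = id + (g₁ᵖ, …, gₙᵖ)` (Jacobian `= 1`): `(i)`
   gives `inv f (X.comap σ) y = inv f X (σ y)`, i.e. invariance of `inv` under the induced
   automorphisms of completed local rings — nothing beyond formal-coordinate invariance (Artin
   approximation realises every automorphism of the henselisation by an étale correspondence,
   `inv_eq_of_comap_eq_comap`). Recorded so it is not retried.
5. Non-reduced / embedded `X` (design flag S1): `V(x²)`, `V(x²)×𝔸¹`, `(x², xy)`, `x·(x,y)ᴺ`,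
   `V(f²)`: the maximum locus is the non-regular locus or its worst stratum, the strict transform
   on `B₊` is computed monomially (saturation of a monomial ideal in `s, x', y'` = delete the
   `s`-powers; the vertex `V(x', y')` is removed) and is regular or of strictly smaller type in
   ≤ 2 moves; `V(f²)` follows `V(f)` move for move and ends with a weight-`w` divisorial centre
   whose strict transform is empty. No S1-based kill. -/

/-! ## §C3.4 Families run in cycle 3 (all die) and the one-step principle

ONE-STEP PRINCIPLE (Parts I–II §5 in Lean as the weighted scaling identity; restated): if `f` is
quasi-homogeneous of degree `d` for weights `w` supported on variables `u` (weight `0` on the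
others `v`) then on the `u`-weighted cobordant blow-up `x_u = s^{w} x_u'`, `f = s^d f(x_u', v)`,
the strict transform is `V(f(x_u', v))` on `B₊ = {x_u' ≠ 0}`, i.e. `(V(f) ∖ V(u))`-types `× 𝔸¹_s`.
If `Sing V(f) ⊆ V(u)` it is smooth: ONE move resolves, whatever `p`. If `Sing V(f) ⊄ V(u)` but the
maximum locus is `V(u)` (e.g. `{0}`), every exceptional type already occurs on `Y` off the max
locus, hence is `< max` by the definition of the max locus: `(iv)` HOLDS for this move for every
rating — the move is always legal and strictly simplifying.

F1. BINOMIAL / TORIC `f = xᵖ + yᵃzᵇ` (`p ∤ a`, `p ∤ b`; `−1` is a `p`-th power). `Sing = ` the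
  `y`- and `z`-axes; the rank-2 torus `(λ,μ)·(x,y,z) = (λᵃμᵇx, λᵖy, μᵖz)` is transitive on each
  punctured axis, so by `(usc)` + `(iii)` (two axes through `0` are not a regular centre) the max
  locus is `{0}`, one axis, or (if `a = b`, swap symmetry, Part II §4) exactly `{0}`. Torus +
  `centre_piece_eq_comap` make every piece monomial; q.h. coordinates of the torus weights of
  `x, y, z` are unique (`xᵐyⁱzʲ ~ x ⇒ m = 1, i = j = 0` since `p ∤ a`), so the centre is
  `(x^{1/α}, y^{1/β}, z^{1/γ})`. The torus weights themselves are admissible and legal (one-step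
  principle, second case); the exceptional types are the punctured-axis types `[xᵖ + zᵇ] × 𝔸¹`,
  `[xᵖ + yᵃ] × 𝔸¹`, isolated q.h. plane curves, which die in one more move. If `p | a`:
  punctured `z`-axis type is `[xᵖ + z·y^{pa'}]`, see F2. Binomials never reproduce.
F2. `g = xᵖ + z·y^{pa'}` (and `xᵖ + yᵖz`): `Sing = z`-axis, and `τ_c : (x,y,z) ↦ (x + c^{1/p}y^{a'},
  y, z − c)` (`k` perfect) is an automorphism of `(𝔸³, V(g))` moving `0` to `(0,0,−c)`: with the
  torus, the only nonempty closed invariant subset of the axis is the axis, so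
  `maxLocus_eq_of_homogeneous` gives max locus = `z`-axis for every datum; centre
  `(x^{1/α}, y^{1/β})` (torus-unique q.h. coordinates; `z`-dependence excluded by weights) with
  `ν(τ_c^* x) = min(α, a'β) = α`, i.e. `α ≤ a'β`. The admissible choice `α = a'β` is q.h. in
  `(x, y)` with `Sing ⊆ V(x, y)`: one move. (`τ`-symmetries of `p`-th-root type only ever BOUND
  weights, `α ≤ jβ`; they never exclude the balanced weight, so they cannot empty the set of
  admissible centres.)
F3. `𝔾ₐ`-CLASS `f = F(y, N)`, `N = xᵖ + yᵖz`, `F ∈ k[y, N]` NOT q.h. (no torus; only `τ_c` and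
  Frobenius conjugation constrain). `∂ₓf = 0`, `∂_z f = F_N yᵖ`, `∂_y f = F_y`: over `y ≠ 0` the
  pair is the smooth pull-back of the plane curve `(𝔸², V(F))` along `(y, N)` (`(i)`: nothing new);
  on `y = 0` sit the honest surface points. Worked case `p = 2`, `F = (N + y³)² + y⁷`, i.e.
  `f = (x² + y²z + y³)² + y⁷`: `Sing = z`-axis, homogeneous under `τ_c` ⇒ max locus = axis,
  centre `(x^{1/α}, y^{1/β})`, `α ≤ β`. With `α = β`: `M' = x'² + y'²(z + s^β y')`, put
  `z₁ = z + s^β y'`; `G = (x'² + y'²z₁)² + s^{3β}y'⁷`; exceptional points have `y' ≠ 0`, and in the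
  local coordinate `z₂ = (x'/y')² + z₁` one gets `G = y'⁴(z₂² + s^{3β} y'³)`: for `β` odd,
  `z₂² + s₁^{3β}` (absorb the unit by a `3β`-th root, `p = 2 ∤ 3β`) = cusp `A_{3β−1} × 𝔸²`, q.h.
  isolated ⇒ one more move; for `β` even, `(z₂ + √u₀ s^{3β/2})² + ũ s^{3β} ≅ z₃² + y₂ s^{3β}`, the
  binomial umbrella of F1/F2 ⇒ two more moves. Dies in ≤ 3; the designer's `β = 1` is best. The
  adversary's lever here — make the leading form a `p`-th power (`∇ ≡ 0`) and kill the
  `s`-linear term (`∂_s G|_{s=0} = f_{d+1}`) so that EVERY exceptional point is singular — is real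
  (`β ≥ 2` does it), but the designer controls `β`, and with primitive weights consecutive
  weighted degrees differ by 1, so `f_{d+1} ≢ 0` generically; forcing `f_{d+1} ≡ 0` on `V(f_d)`
  (e.g. `N² + y⁶ = (N + y³)²`) made the examples non-reduced or shifted them back into F1/F2.
F4. Char-2 Whitney umbrella `x² + y²z`: every closed axis point is a pinch point
  (`τ_d : (x,y,z) ↦ (x + dy, y, z + d²)`), max locus = axis (homogeneous criterion), `τ_d` forces
  `α ≤ β`, and `α = β = 1` gives `x'² + y'²z` on `{(x',y') ≠ 0}`: smooth. One move.
F5. Census specimen `z⁸ + x²y⁸(1+y)` over `𝔽₂` (ideator r1-k1, triage r1-1 F2): `Sing =` two axes in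
  `z = 0`; not q.h.; point centres fail to lower `(ν, ν₁)` for all 4096 small weights, but that is
  a statement about ONE numerical rating; the datum may rate `0` equal to the `x`-axis type and
  blow up the axis with weights (1,1) (order drops to 2). Not a reproduction, no kill.

UPSHOT. To feed `not_nonempty_of_isolated_reproduction` / `…_homogeneous_reproduction` one needs a
germ and a proof about ALL regular weighted centres on its forced max locus. Symmetry shrinks
"all" to a lattice of weights (F1, F2, F4) or a half-lattice (τ-bounds), and on those the balanced
/ primitive weight always wins; without symmetry "all" includes every formal flag and every weight
and nothing is known to survive them. This is the precise sense in which the crux "resists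
because it is the open problem": AbramovichTemkinWlodarczyk2024 §1.9, AQS arXiv:2412.16426 p. 3. -/

/-! ## §C3.5 Near-misses and targets

* No `sorry` in this part. No targets (payload `stuck_stubs = []`; no line picked for this crux).
* NEAR-MISS (not attempted in Lean, would be Part IV material): the scheme-level one-step
  principle `B₊`-chart isomorphism and the weight-1 inertness `Localization.Away (ut)
  (extReesAlgebra (uⁿ)) ≃ₐ[A] A[T;T⁻¹]` — both are statements about
  `Literature…extReesAlgebra` that a prover of `DatumToResolution` (stmt-8974) will need anyway
  (comparison of `cobordantPlus` charts with Włodarczyk's `B₊`). -/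

end Summit.ResolutionOfSingularities.ResolutionOfSingularities.Cruxes.WeightedConstruction.Disproof

end
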